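import Summits.AnomalousDissipation.AnomalousDissipation.Theorems.SawtoothPulseCascadeK1LocalisedCascadeThinRatioBlocks
import Summits.AnomalousDissipation.AnomalousDissipation.Theorems.SawtoothPulseCascadeK1LocalisedCascadeCanonicalBlocks

/-!
# K1loc — helper: THE GEOMETRIC FIBRE-BLOCK FAMILY `Λ_m = ⌊Λ₀aᵐ/bᵐ⌋` OF ARBITRARY RATIO `a/b > 1` (arithmetic layer)

Helper file of the prover lane on the crux `K1LocalisedCascade` (stmt-AnomalousDissipation-19491), route `SawtoothPulseCascade`
(S-D seat, arbiter A24-4: the phase-3 CT ledger; finding F-p1g8-1 §2).  In the corner-trace grade the residue coefficient of a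
fibre block scales like the cube of the lobe/gap ratio, which is proportional to the block ratio `Λ_{m+1}/Λ_m`: the dyadic
canonical blocks (`…CanonicalBlocks`, ratio `2`) lose a factor `≈ 5` against ad-k1loc-p3's sizing (ratio `1.1–1.2`).  This file is
the arithmetic of the family `Λ_m = ⌊Λ₀aᵐ/bᵐ⌋` (natural division, `0 < b ≤ a`) — the `a = 9, b = 8` case is ad-k1loc-p2's
`…ThinRatioBlocks` — with the THIN cut-offs `Q₂^m = ⌊q_nΛ_m/q_d⌋` (lobe) and `Q₁^m = ⌊u′Λ_{m+1}/v′⌋` (plateau = feed cut-off):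
* §1 the family: `geom_blocks_monotone`, `geom_blocks_ge` (`Λ_m ≥ Λ₀`), `geom_blocks_zero`, `geom_blocks_succ_le`
  (`bΛ_{m+1} ≤ aΛ_m + (a − 1)`), `geom_blocks_real` (`Λ₀(a/b)^m − 1 ≤ Λ_m ≤ Λ₀(a/b)^m`), `geom_blocks_real_ge`
  (`(Λ₀ − 1)(a/b)^m ≤ Λ_m`);
* §2 cut-offs on every block from slope + base integer inequalities at `Λ₀`: `geom_sep` (`Q₁^m < Q₂^m`), `geom_frac`
  (`c_d·u′Λ_{m+1} ≤ c_n·v′Q₂^m`, whence `r_m ≤ (c_d + c_n)/(c_d − c_n)` by `…CanonicalThinBlocks.thin_r_le`);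
* §3 the real envelopes consumed by `…BlockJunkCTEGeom`: lobe `Q₂^m ≤ (q_n/q_d)Λ₀·(a/b)^m`, ratio-class gap
  `((uG−v)Λ_m − uQ₂^m)/u ≥ ((uG−v)q_d − uq_n)(Λ₀−1)/(uq_d)·(a/b)^m` and span `= (uG−v)Λ_m/u ≥ (uG−v)(Λ₀−1)/u·(a/b)^m`, strip gap
  `Λ_mG − (K + Q₂^m) ≥ ((Gq_d − q_n)(Λ₀−1) − Kq_d)/q_d·(a/b)^m` and span `Λ_mG − K ≥ (G(Λ₀−1) − K)(a/b)^m`, top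
  `Λ_{m+1}G ≤ Λ₀G·(a/b)^{m+1}`.
Pure natural/real arithmetic; no definitions; no statement about the crux. [cite: Grafakos2014, Prop. 3.2.7 (3)] [problem: turb]
-/

-- `Summit.<Summit>.<Problem>`: single-conjunct summit, the duplicate namespace segment is deliberate.
set_option linter.dupNamespace false

noncomputable section

namespace Summit.AnomalousDissipation.AnomalousDissipation.Theorems.SawtoothPulseCascade.K1Window

open Finset

/-! ## §1 The family `Λ_m = ⌊Λ₀aᵐ/bᵐ⌋` -/

/-- `Λ_m ≤ Λ_{m+1}` for `0 < b ≤ a`: the family is monotone. [folklore] -/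
theorem geom_blocks_monotone {a b : ℕ} (hb : 0 < b) (hab : b ≤ a) (Λ0 : ℕ) :
    Monotone fun m : ℕ => Λ0 * a ^ m / b ^ m := by
  refine monotone_nat_of_le_succ fun m => ?_
  show Λ0 * a ^ m / b ^ m ≤ Λ0 * a ^ (m + 1) / b ^ (m + 1)
  calc Λ0 * a ^ m / b ^ m = b * (Λ0 * a ^ m) / (b * b ^ m) := (Nat.mul_div_mul_left _ _ hb).symm
    _ ≤ a * (Λ0 * a ^ m) / (b * b ^ m) := Nat.div_le_div_right (Nat.mul_le_mul_right _ hab)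
    _ = Λ0 * a ^ (m + 1) / b ^ (m + 1) := by rw [pow_succ, pow_succ]; ring_nf

/-- `Λ₀ ≤ Λ_m` for `0 < b ≤ a`. [folklore] -/
theorem geom_blocks_ge {a b : ℕ} (hb : 0 < b) (hab : b ≤ a) (Λ0 m : ℕ) : Λ0 ≤ Λ0 * a ^ m / b ^ m := by
  have hbm : 0 < b ^ m := by positivity
  calc Λ0 = Λ0 * b ^ m / b ^ m := (Nat.mul_div_cancel Λ0 hbm).symm
    _ ≤ Λ0 * a ^ m / b ^ m := Nat.div_le_div_right (Nat.mul_le_mul_left _ (Nat.pow_le_pow_left hab m))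

/-- `Λ_0 = Λ₀`. [folklore] -/
theorem geom_blocks_zero (Λ0 a b : ℕ) : Λ0 * a ^ 0 / b ^ 0 = Λ0 := by simp

/-- **Slow growth**: `bΛ_{m+1} ≤ aΛ_m + (a − 1)` (`0 < b`, `1 ≤ a`). [folklore] -/
theorem geom_blocks_succ_le {a b : ℕ} (hb : 0 < b) (ha : 1 ≤ a) (Λ0 m : ℕ) :
    b * (Λ0 * a ^ (m + 1) / b ^ (m + 1)) ≤ a * (Λ0 * a ^ m / b ^ m) + (a - 1) := by
  set x := Λ0 * a ^ m with hx
  set y := b ^ m with hy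
  have hy0 : 0 < y := by rw [hy]; positivity
  have e1 : Λ0 * a ^ (m + 1) / b ^ (m + 1) = a * x / y / b := by
    rw [pow_succ, pow_succ, ← mul_assoc, ← hx, ← hy, Nat.div_div_eq_div_mul]; ring_nf
  rw [e1]
  have h1 : b * (a * x / y / b) ≤ a * x / y := by rw [mul_comm]; exact Nat.div_mul_le_self _ _
  have h2 : a * x / y ≤ a * (x / y) + (a - 1) := by
    have hmod : x % y < y := Nat.mod_lt _ hy0
    have ex : a * x = a * (x % y) + a * (x / y) * y := by
      have := Nat.div_add_mod x y
      nlinarith [this]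
    rw [ex, Nat.add_mul_div_right _ _ hy0]
    have h3 : a * (x % y) / y ≤ a - 1 := by
      have : a * (x % y) / y < a := by
        rw [Nat.div_lt_iff_lt_mul hy0]
        calc a * (x % y) < a * y := Nat.mul_lt_mul_of_pos_left hmod (by omega)
          _ = a * y := rfl
      omega
    omega
  exact h1.trans h2

/-- **Real sandwich**: `Λ₀(a/b)^m − 1 ≤ Λ_m ≤ Λ₀(a/b)^m` (`0 < b`). [folklore] -/
theorem geom_blocks_real {a b : ℕ} (hb : 0 < b) (Λ0 m : ℕ) :
    (Λ0 : ℝ) * ((a : ℝ) / b) ^ m - 1 ≤ ((Λ0 * a ^ m / b ^ m : ℕ) : ℝ) ∧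
      ((Λ0 * a ^ m / b ^ m : ℕ) : ℝ) ≤ (Λ0 : ℝ) * ((a : ℝ) / b) ^ m := by
  have hbr : (0 : ℝ) < b := by exact_mod_cast hb
  have hbm : (0 : ℝ) < (b : ℝ) ^ m := by positivity
  have e : (Λ0 : ℝ) * ((a : ℝ) / b) ^ m = ((Λ0 * a ^ m : ℕ) : ℝ) / ((b ^ m : ℕ) : ℝ) := by
    push_cast
    rw [div_pow]; ring
  rw [e]
  constructor
  · have h := Nat.lt_div_mul_add (a := Λ0 * a ^ m) (b := b ^ m) (by positivity)
    have h' : ((Λ0 * a ^ m : ℕ) : ℝ) < ((Λ0 * a ^ m / b ^ m : ℕ) : ℝ) * ((b ^ m : ℕ) : ℝ) + ((b ^ m : ℕ) : ℝ) := by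
      exact_mod_cast h
    have hbm' : (0 : ℝ) < ((b ^ m : ℕ) : ℝ) := by exact_mod_cast (by positivity : 0 < b ^ m)
    rw [sub_le_iff_le_add, div_le_iff₀ hbm']
    linarith
  · exact Nat.cast_div_le

/-- **Geometric lower envelope**: `(Λ₀ − 1)(a/b)^m ≤ Λ_m` (`0 < b ≤ a`). [folklore] -/
theorem geom_blocks_real_ge {a b : ℕ} (hb : 0 < b) (hab : b ≤ a) (Λ0 m : ℕ) :
    ((Λ0 : ℝ) - 1) * ((a : ℝ) / b) ^ m ≤ ((Λ0 * a ^ m / b ^ m : ℕ) : ℝ) := by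
  have h := (geom_blocks_real hb Λ0 m (a := a)).1
  have hbr : (0 : ℝ) < b := by exact_mod_cast hb
  have hρ : (1 : ℝ) ≤ (a : ℝ) / b := by
    rw [le_div_iff₀ hbr, one_mul]; exact_mod_cast hab
  have hp : (1 : ℝ) ≤ ((a : ℝ) / b) ^ m := one_le_pow₀ hρ
  nlinarith

/-! ## §2 The thin cut-offs on every block from slope + base at `Λ₀` -/

/-- **Separation `Q₁ < Q₂` on a block** (`Q₁ = ⌊u′Λ′/v′⌋`, `Q₂ = ⌊q_nΛ/q_d⌋`): slow growth `bΛ′ ≤ aΛ + (a − 1)`, `Λ₀ ≤ Λ`,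
(slope) `aq_du′ ≤ bv′q_n` and (base) `q_d(u′(a − 1) + bv′) + aq_du′Λ₀ ≤ bv′q_nΛ₀` give `⌊u′Λ′/v′⌋ < ⌊q_nΛ/q_d⌋`. [folklore] -/
theorem geom_sep {a b u' v' qn qd Λ0 Λ Λ' : ℕ} (hb : 0 < b) (hv' : 0 < v') (hqd : 0 < qd)
    (hsucc : b * Λ' ≤ a * Λ + (a - 1)) (hΛ : Λ0 ≤ Λ)
    (hslope : a * qd * u' ≤ b * v' * qn) (hbase : qd * (u' * (a - 1) + b * v') + a * qd * u' * Λ0 ≤ b * v' * qn * Λ0) :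
    u' * Λ' / v' < qn * Λ / qd := by
  have key : qd * (u' * Λ' + v') ≤ v' * qn * (1 * Λ - 0) := by
    rw [Nat.sub_zero, one_mul]
    have hbb : b * (qd * (u' * Λ' + v')) ≤ b * (v' * qn * Λ) := by
      calc b * (qd * (u' * Λ' + v')) = qd * u' * (b * Λ') + qd * b * v' := by ring
        _ ≤ qd * u' * (a * Λ + (a - 1)) + qd * b * v' := by gcongr
        _ = (qd * (u' * (a - 1) + b * v') + a * qd * u' * Λ0) + a * qd * u' * (Λ - Λ0) := by
            zify [hΛ]; ring
        _ ≤ b * v' * qn * Λ0 + b * v' * qn * (Λ - Λ0) := Nat.add_le_add hbase (Nat.mul_le_mul_right _ hslope)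
        _ = b * (v' * qn * Λ) := by zify [hΛ]; ring
    exact Nat.le_of_mul_le_mul_left hbb hb
  have h := thin_Q₁_lt_Q₂ (u' := u') (v' := v') (θn := qn) (θd := qd) (G := 1) (K := 0) (Λ := Λ) (Λ' := Λ') hv' hqd key
  simpa [Nat.sub_zero] using h

/-- **Cut-off fraction on a block**: slow growth `bΛ′ ≤ aΛ + (a − 1)`, `Λ₀ ≤ Λ`, (slope) `aq_dc_du′ ≤ bc_nv′q_n` and (base)
`q_dc_du′(aΛ₀ + (a − 1)) + bc_nv′q_d ≤ bc_nv′q_nΛ₀` give `c_d·u′Λ′ ≤ c_n·v′·⌊q_nΛ/q_d⌋`. [folklore] -/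
theorem geom_frac {a b u' v' qn qd cn cd Λ0 Λ Λ' : ℕ} (hb : 0 < b) (hqd : 0 < qd)
    (hsucc : b * Λ' ≤ a * Λ + (a - 1)) (hΛ : Λ0 ≤ Λ)
    (hslope : a * qd * cd * u' ≤ b * cn * v' * qn)
    (hbase : qd * cd * u' * (a * Λ0 + (a - 1)) + b * cn * v' * qd ≤ b * cn * v' * qn * Λ0) :
    cd * (u' * Λ') ≤ cn * (v' * (qn * Λ / qd)) := by
  -- `q_d·Q₂ ≥ q_nΛ − (q_d − 1)`
  have hfloor : qn * Λ < (qn * Λ / qd) * qd + qd := Nat.lt_div_mul_add hqd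
  -- it suffices that `q_d·(c_du′Λ′) + c_nv′q_d ≤ c_nv′·q_nΛ`
  suffices h : qd * (cd * (u' * Λ')) + cn * v' * qd ≤ cn * v' * (qn * Λ) by
    have h2 : cn * v' * (qn * Λ) ≤ cn * v' * ((qn * Λ / qd) * qd + qd) := Nat.mul_le_mul_left _ hfloor.le
    have h3 : qd * (cd * (u' * Λ')) ≤ qd * (cn * (v' * (qn * Λ / qd))) := by
      have := h.trans h2
      have e : cn * v' * ((qn * Λ / qd) * qd + qd) = qd * (cn * (v' * (qn * Λ / qd))) + cn * v' * qd := by ring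
      rw [e] at this
      omega
    exact Nat.le_of_mul_le_mul_left h3 hqd
  have hbb : b * (qd * (cd * (u' * Λ')) + cn * v' * qd) ≤ b * (cn * v' * (qn * Λ)) := by
    calc b * (qd * (cd * (u' * Λ')) + cn * v' * qd) = qd * cd * u' * (b * Λ') + b * cn * v' * qd := by ring
      _ ≤ qd * cd * u' * (a * Λ + (a - 1)) + b * cn * v' * qd := by gcongr
      _ = (qd * cd * u' * (a * Λ0 + (a - 1)) + b * cn * v' * qd) + a * qd * cd * u' * (Λ - Λ0) := by
          zify [hΛ]; ring
      _ ≤ b * cn * v' * qn * Λ0 + b * cn * v' * qn * (Λ - Λ0) :=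
          Nat.add_le_add hbase (Nat.mul_le_mul_right _ hslope)
      _ = b * (cn * v' * (qn * Λ)) := by zify [hΛ]; ring
  exact Nat.le_of_mul_le_mul_left hbb hb

/-! ## §3 Real envelopes of the lobe, the gaps, the spans and the block tops -/

/-- **Lobe envelope**: `⌊q_nΛ_m/q_d⌋ ≤ (q_nΛ₀/q_d)·(a/b)^m`. [folklore] -/
theorem geom_Q₂_le {a b : ℕ} (hb : 0 < b) (qn qd Λ0 m : ℕ) :
    ((qn * (Λ0 * a ^ m / b ^ m) / qd : ℕ) : ℝ) ≤ (qn : ℝ) * Λ0 / qd * ((a : ℝ) / b) ^ m := by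
  have h1 := canon_Q₂_le qn qd (Λ0 * a ^ m / b ^ m)
  have h2 := (geom_blocks_real hb Λ0 m (a := a)).2
  calc ((qn * (Λ0 * a ^ m / b ^ m) / qd : ℕ) : ℝ) ≤ (qn : ℝ) / qd * ((Λ0 * a ^ m / b ^ m : ℕ) : ℝ) := h1
    _ ≤ (qn : ℝ) / qd * ((Λ0 : ℝ) * ((a : ℝ) / b) ^ m) := mul_le_mul_of_nonneg_left h2 (by positivity)
    _ = (qn : ℝ) * Λ0 / qd * ((a : ℝ) / b) ^ m := by ring

/-- **Top envelope**: `Λ_{m+1}G ≤ Λ₀G·(a/b)^{m+1}`. [folklore] -/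
theorem geom_top_le {a b : ℕ} (hb : 0 < b) (G Λ0 m : ℕ) :
    (((Λ0 * a ^ (m + 1) / b ^ (m + 1)) * G : ℕ) : ℝ) ≤ (Λ0 : ℝ) * G * ((a : ℝ) / b) ^ (m + 1) := by
  have h2 := (geom_blocks_real hb Λ0 (m + 1) (a := a)).2
  push_cast
  nlinarith [Nat.cast_nonneg (α := ℝ) G]

/-- **Ratio-class gap envelope**: `((uG−v)q_d − uq_n)(Λ₀−1)/(uq_d)·(a/b)^m ≤ ((uG−v)Λ_m − uQ₂^m)/u` (`0 < u`, `0 < q_d`,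
`uq_n ≤ (uG−v)q_d`, `0 < b ≤ a`). [folklore] -/
theorem geom_ratio_den_ge {a b u v G qn qd Λ0 : ℕ} (hb : 0 < b) (hab : b ≤ a) (hu : 0 < u) (hqd : 0 < qd)
    (hvu : v ≤ u * G) (hq : u * qn ≤ qd * (u * G - v)) (m : ℕ) :
    (((u : ℝ) * G - v) * qd - u * qn) * ((Λ0 : ℝ) - 1) / (u * qd) * ((a : ℝ) / b) ^ m ≤
      (((u : ℝ) * G - v) * ((Λ0 * a ^ m / b ^ m : ℕ) : ℝ) - u * ((qn * (Λ0 * a ^ m / b ^ m) / qd : ℕ) : ℝ)) / u := by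
  have hur : (0 : ℝ) < u := by exact_mod_cast hu
  have hqdr : (0 : ℝ) < qd := by exact_mod_cast hqd
  set Λ : ℕ := Λ0 * a ^ m / b ^ m with hΛdef
  have hQle : ((qn * Λ / qd : ℕ) : ℝ) ≤ (qn : ℝ) / qd * Λ := canon_Q₂_le qn qd Λ
  have hΛge : ((Λ0 : ℝ) - 1) * ((a : ℝ) / b) ^ m ≤ (Λ : ℝ) := geom_blocks_real_ge hb hab Λ0 m
  have hc : (0 : ℝ) ≤ ((u : ℝ) * G - v) * qd - u * qn := by
    have h1 : ((u * qn : ℕ) : ℝ) ≤ ((qd * (u * G - v) : ℕ) : ℝ) := by exact_mod_cast hq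
    rw [Nat.cast_mul, Nat.cast_mul, Nat.cast_sub hvu, Nat.cast_mul] at h1
    linarith
  -- `((uG−v)Λ − uQ₂)/u ≥ ((uG−v) − uq_n/q_d)Λ/u ≥ … (Λ₀−1)ρ^m`
  have h1 : (((u : ℝ) * G - v) * qd - u * qn) / qd * (Λ : ℝ) ≤ ((u : ℝ) * G - v) * Λ - u * ((qn * Λ / qd : ℕ) : ℝ) := by
    have := mul_le_mul_of_nonneg_left hQle hur.le
    have e : (((u : ℝ) * G - v) * qd - u * qn) / qd * (Λ : ℝ) = ((u : ℝ) * G - v) * Λ - u * ((qn : ℝ) / qd * Λ) := by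
      field_simp
    rw [e]; linarith
  have h2 : (((u : ℝ) * G - v) * qd - u * qn) / qd * (((Λ0 : ℝ) - 1) * ((a : ℝ) / b) ^ m) ≤
      (((u : ℝ) * G - v) * qd - u * qn) / qd * (Λ : ℝ) := mul_le_mul_of_nonneg_left hΛge (by positivity)
  have e2 : (((u : ℝ) * G - v) * qd - u * qn) * ((Λ0 : ℝ) - 1) / (u * qd) * ((a : ℝ) / b) ^ m =
      (((u : ℝ) * G - v) * qd - u * qn) / qd * (((Λ0 : ℝ) - 1) * ((a : ℝ) / b) ^ m) / u := by
    field_simp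
  rw [e2]
  exact div_le_div_of_nonneg_right (h2.trans h1) hur.le

/-- **Ratio-class span**: `(uG−v)(Λ₀−1)/u·(a/b)^m ≤ ((uG−v)Λ_m − uQ₂^m)/u + Q₂^m` (`= (uG−v)Λ_m/u`). [folklore] -/
theorem geom_ratio_span_ge {a b u v G qn qd Λ0 : ℕ} (hb : 0 < b) (hab : b ≤ a) (hu : 0 < u) (hvu : v ≤ u * G) (m : ℕ) :
    ((u : ℝ) * G - v) * ((Λ0 : ℝ) - 1) / u * ((a : ℝ) / b) ^ m ≤
      (((u : ℝ) * G - v) * ((Λ0 * a ^ m / b ^ m : ℕ) : ℝ) - u * ((qn * (Λ0 * a ^ m / b ^ m) / qd : ℕ) : ℝ)) / u +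
        ((qn * (Λ0 * a ^ m / b ^ m) / qd : ℕ) : ℝ) := by
  have hur : (0 : ℝ) < u := by exact_mod_cast hu
  have hc2 : (0 : ℝ) ≤ (u : ℝ) * G - v := by
    have : (v : ℝ) ≤ (u : ℝ) * G := by exact_mod_cast hvu
    linarith
  have hΛge := geom_blocks_real_ge hb hab Λ0 m
  have e : (((u : ℝ) * G - v) * ((Λ0 * a ^ m / b ^ m : ℕ) : ℝ) - u * ((qn * (Λ0 * a ^ m / b ^ m) / qd : ℕ) : ℝ)) / u +
      ((qn * (Λ0 * a ^ m / b ^ m) / qd : ℕ) : ℝ) = ((u : ℝ) * G - v) / u * ((Λ0 * a ^ m / b ^ m : ℕ) : ℝ) := by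
    field_simp
    ring
  rw [e]
  have e2 : ((u : ℝ) * G - v) * ((Λ0 : ℝ) - 1) / u * ((a : ℝ) / b) ^ m =
      ((u : ℝ) * G - v) / u * (((Λ0 : ℝ) - 1) * ((a : ℝ) / b) ^ m) := by ring
  rw [e2]
  exact mul_le_mul_of_nonneg_left hΛge (by positivity)

/-- **Strip gap envelope**: `(((Gq_d − q_n)(Λ₀−1) − Kq_d)/q_d)·(a/b)^m ≤ Λ_mG − (K + Q₂^m)` (`0 < q_d`, `0 < b ≤ a`,
`q_n ≤ Gq_d`). [folklore] -/
theorem geom_strip_den_ge {a b K G qn qd Λ0 : ℕ} (hb : 0 < b) (hab : b ≤ a) (hqd : 0 < qd) (hq : qn ≤ G * qd) (m : ℕ) :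
    (((G : ℝ) * qd - qn) * ((Λ0 : ℝ) - 1) - K * qd) / qd * ((a : ℝ) / b) ^ m ≤
      (((Λ0 * a ^ m / b ^ m) * G : ℕ) : ℝ) - ((K + qn * (Λ0 * a ^ m / b ^ m) / qd : ℕ) : ℝ) := by
  have hqdr : (0 : ℝ) < qd := by exact_mod_cast hqd
  set Λ : ℕ := Λ0 * a ^ m / b ^ m with hΛdef
  have hQle : ((qn * Λ / qd : ℕ) : ℝ) ≤ (qn : ℝ) / qd * Λ := canon_Q₂_le qn qd Λ
  have hΛge : ((Λ0 : ℝ) - 1) * ((a : ℝ) / b) ^ m ≤ (Λ : ℝ) := geom_blocks_real_ge hb hab Λ0 m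
  have hbr : (0 : ℝ) < b := by exact_mod_cast hb
  have hρ1 : (1 : ℝ) ≤ ((a : ℝ) / b) ^ m :=
    one_le_pow₀ (by rw [le_div_iff₀ hbr, one_mul]; exact_mod_cast hab)
  have hc : (0 : ℝ) ≤ (G : ℝ) * qd - qn := by
    have : (qn : ℝ) ≤ (G : ℝ) * qd := by exact_mod_cast hq
    linarith
  have eKQ : ((K + qn * Λ / qd : ℕ) : ℝ) = (K : ℝ) + ((qn * Λ / qd : ℕ) : ℝ) := by push_cast; rfl
  have eΛG : ((Λ * G : ℕ) : ℝ) = (Λ : ℝ) * G := by push_cast; rfl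
  rw [eKQ, eΛG]
  -- `Λ G − K − Q₂ ≥ (G − q_n/q_d)Λ − K ≥ (G − q_n/q_d)(Λ₀−1)ρ^m − Kρ^m`
  have h1 : ((G : ℝ) * qd - qn) / qd * (Λ : ℝ) - K ≤ (Λ : ℝ) * G - ((K : ℝ) + ((qn * Λ / qd : ℕ) : ℝ)) := by
    have e : ((G : ℝ) * qd - qn) / qd * (Λ : ℝ) = (Λ : ℝ) * G - (qn : ℝ) / qd * Λ := by field_simp
    rw [e]; linarith
  have h2 : ((G : ℝ) * qd - qn) / qd * (((Λ0 : ℝ) - 1) * ((a : ℝ) / b) ^ m) ≤ ((G : ℝ) * qd - qn) / qd * (Λ : ℝ) :=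
    mul_le_mul_of_nonneg_left hΛge (by positivity)
  have h3 : (K : ℝ) ≤ K * ((a : ℝ) / b) ^ m := le_mul_of_one_le_right (Nat.cast_nonneg K) hρ1
  have e2 : (((G : ℝ) * qd - qn) * ((Λ0 : ℝ) - 1) - K * qd) / qd * ((a : ℝ) / b) ^ m =
      ((G : ℝ) * qd - qn) / qd * (((Λ0 : ℝ) - 1) * ((a : ℝ) / b) ^ m) - K * ((a : ℝ) / b) ^ m := by
    field_simp
  rw [e2]
  linarith

/-- **Strip span**: `(G(Λ₀−1) − K)(a/b)^m ≤ Λ_mG − (K + Q₂^m) + Q₂^m` (`= Λ_mG − K`). [folklore] -/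
theorem geom_strip_span_ge {a b K G qn qd Λ0 : ℕ} (hb : 0 < b) (hab : b ≤ a) (m : ℕ) :
    ((G : ℝ) * ((Λ0 : ℝ) - 1) - K) * ((a : ℝ) / b) ^ m ≤
      (((Λ0 * a ^ m / b ^ m) * G : ℕ) : ℝ) - ((K + qn * (Λ0 * a ^ m / b ^ m) / qd : ℕ) : ℝ) +
        ((qn * (Λ0 * a ^ m / b ^ m) / qd : ℕ) : ℝ) := by
  have hΛge := geom_blocks_real_ge hb hab Λ0 m
  have hbr : (0 : ℝ) < b := by exact_mod_cast hb
  have hρ1 : (1 : ℝ) ≤ ((a : ℝ) / b) ^ m :=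
    one_le_pow₀ (by rw [le_div_iff₀ hbr, one_mul]; exact_mod_cast hab)
  have h3 : (K : ℝ) ≤ K * ((a : ℝ) / b) ^ m := le_mul_of_one_le_right (Nat.cast_nonneg K) hρ1
  push_cast
  nlinarith [Nat.cast_nonneg (α := ℝ) G, mul_le_mul_of_nonneg_left hΛge (Nat.cast_nonneg (α := ℝ) G)]

end Summit.AnomalousDissipation.AnomalousDissipation.Theorems.SawtoothPulseCascade.K1Window
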